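import Summits.Ventures.YMGap.Thresholds.OneLinkLevelTwoModulus
import Summits.Ventures.YMGap.Thresholds.OneLinkEigenRows
import HarnessLib

/-!
# Venture YMGap — the one-link modulus beyond first order, part 16: ROWS of the level-two modulus through the star door —
# `MassGapAt 4 N x` for every `N ≥ 4 / 6 / 10 / 20 / 50` beyond the refined first-order rows

HONEST FRAMING: venture file of the cell `pub-ymgap` (QuantumFields programme), strong-coupling LATTICE statements for `SU(N)`
lattice Yang–Mills on `ℤ⁴` (Wilson action, tree coupling `N·x`, 't Hooft `x`); nothing about the continuum; no decay rate beyond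
`∃ c > 0`.  OUTPUT (hypothesis-free, kernel-checked), from `oneLinkKRModulus_levelTwo` (second order of the covariance hierarchy,
CRUDE column of the cell note `HOME/p2/ONE-LINK-HIERARCHY.md` §5) through ds-1's star door
`StarSUNLimit.star_massGapAt_of_oneLinkKRModulus` (`4·K·|x| ≤ 9/25` on the ball `R = 6|x|`):
* `levelTwoE_le`, `levelTwoK_le`: the bracket `K₂(N,R)` is decreasing in `N` and increasing in `R`; numerical envelope with a
  rational `q ≤ √(1/2 − R₀)`;
* `improvedThreshold_SU_levelTwo_four (4 ≤ N) : ImprovedThreshold 4 N (4/125)` (`0.032`; refined/BE: `1/32 = 0.03125`),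
  `improvedThreshold_SU_levelTwo_six (6 ≤ N) : ImprovedThreshold 4 N (69/2000)` (`0.0345`; refined `33/1000`),
  `improvedThreshold_SU_levelTwo_ten (10 ≤ N) : ImprovedThreshold 4 N (73/2000)` (`0.0365`; refined `17/500 = 0.034`),
  `improvedThreshold_SU_levelTwo_twenty (20 ≤ N) : ImprovedThreshold 4 N (3/80)` (`0.0375`; refined `7/200 = 0.035`),
  `improvedThreshold_SU_levelTwo_fifty (50 ≤ N) : ImprovedThreshold 4 N (19/500)` (`0.038`; refined `9/250 = 0.036`).
Against the sharp Bakry–Émery window `1/32 = 0.03125`: `+17 %` (`N ≥ 10`), `+20 %` (`N ≥ 20`), `+22 %` (`N ≥ 50`); against SZZ's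
printed `1/48`: `×1.75 … ×1.82`.  Sentence-grade; the memo's refined column (second-order Schwinger–Dyson means, `L⁴` bounds) would
give `≈ 0.0396 / 0.0433 / 0.0457` and is NOT claimed here.
-/

noncomputable section

open scoped Matrix ComplexConjugate BigOperators ContDiff Matrix.Norms.Frobenius
open Matrix Complex Finset MeasureTheory ProbabilityTheory
open Literature.MathematicalPhysics.QuantumFieldTheory
open Literature.MathematicalPhysics.QuantumFieldTheory.SUNBakryEmery
open Literature.MathematicalPhysics.QuantumFieldTheory.Balaban1983to89.StrongCouplingDobrushinWindow
open Literature.MathematicalPhysics.QuantumFieldTheory.Balaban1983to89.StrongCouplingKernelWindow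

namespace Summit.Ventures.YMGap.OneLinkEigen

variable {N : ℕ}

section LevelTwoRows

open Summit.Ventures.YMGap.StarSUNLimit (star_massGapAt_of_oneLinkKRModulus)
open Summit.Ventures.YMGap.OneLinkEigenRows (casimirFactor_le)

/-- `E(N) = N²/(2(N²−4))` is decreasing in `N ≥ 3`. [folklore] -/
theorem levelTwoE_le {N₀ N : ℕ} (hN₀ : 3 ≤ N₀) (hN : N₀ ≤ N) :
    (N : ℝ) ^ 2 / (2 * ((N : ℝ) ^ 2 - 4)) ≤ (N₀ : ℝ) ^ 2 / (2 * ((N₀ : ℝ) ^ 2 - 4)) := by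
  have h0 : (3 : ℝ) ≤ N₀ := by exact_mod_cast hN₀
  have h1 : (N₀ : ℝ) ≤ N := by exact_mod_cast hN
  have hp0 : (0 : ℝ) < (N₀ : ℝ) ^ 2 - 4 := by nlinarith
  have hp : (0 : ℝ) < (N : ℝ) ^ 2 - 4 := by nlinarith
  rw [div_le_div_iff₀ (by positivity) (by positivity)]
  nlinarith [mul_le_mul h1 h1 (by linarith) (by linarith)]

/-- **Numerical envelope of the level-two bracket**: for `N ≥ N₀ ≥ 3`, `0 ≤ R ≤ R₀ < 1/2` and a rational `q > 0` with
`q² ≤ 1/2 − R₀`, `K₂(N,R) ≤ K₂⁺(N₀,R₀,q)` (every `E(N)`, `C(N)`, `1/N` replaced by its value at `N₀`, `R` by `R₀`, `√(1/2−R)` by `q`).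
[folklore] -/
theorem levelTwoK_le {N₀ : ℕ} (hN₀ : 3 ≤ N₀) (hN : N₀ ≤ N) {R R₀ q : ℝ} (hR0 : 0 ≤ R) (hRR₀ : R ≤ R₀) (hR₀ : R₀ < 1 / 2)
    (hq : 0 < q) (hq2 : q ^ 2 ≤ 1 / 2 - R₀) :
    (N : ℝ) ^ 2 / ((N : ℝ) ^ 2 - 1) *
        (1 + ((N : ℝ) ^ 2 / (2 * ((N : ℝ) ^ 2 - 4))) * R + 4 * ((N : ℝ) ^ 2 / ((N : ℝ) ^ 2 - 1)) * (((N : ℝ) ^ 2 / (2 * ((N : ℝ) ^ 2 - 4))) + 1 / 4) * R ^ 2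
          + 2 * ((((N : ℝ) ^ 2 / (2 * ((N : ℝ) ^ 2 - 4))) + 1 / 4) / N) * (R / Real.sqrt (1 / 2 - R))
          + ((5 * ((N : ℝ) ^ 2 / (2 * ((N : ℝ) ^ 2 - 4))) + 1 / 4) * R ^ 2 + 2 * ((N : ℝ) ^ 2 / ((N : ℝ) ^ 2 - 1)) * (10 * ((N : ℝ) ^ 2 / (2 * ((N : ℝ) ^ 2 - 4))) + 1 / 2) * R ^ 3
              + ((10 * ((N : ℝ) ^ 2 / (2 * ((N : ℝ) ^ 2 - 4))) + 1 / 2) / N) * (R ^ 2 / Real.sqrt (1 / 2 - R))) / (1 / 2 - R)) ≤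
      ((N₀ : ℝ) ^ 2 / ((N₀ : ℝ) ^ 2 - 1)) *
        (1 + ((N₀ : ℝ) ^ 2 / (2 * ((N₀ : ℝ) ^ 2 - 4))) * R₀ + 4 * ((N₀ : ℝ) ^ 2 / ((N₀ : ℝ) ^ 2 - 1)) * (((N₀ : ℝ) ^ 2 / (2 * ((N₀ : ℝ) ^ 2 - 4))) + 1 / 4) * R₀ ^ 2
          + 2 * ((((N₀ : ℝ) ^ 2 / (2 * ((N₀ : ℝ) ^ 2 - 4))) + 1 / 4) / N₀) * (R₀ / q)
          + ((5 * ((N₀ : ℝ) ^ 2 / (2 * ((N₀ : ℝ) ^ 2 - 4))) + 1 / 4) * R₀ ^ 2 + 2 * ((N₀ : ℝ) ^ 2 / ((N₀ : ℝ) ^ 2 - 1)) * (10 * ((N₀ : ℝ) ^ 2 / (2 * ((N₀ : ℝ) ^ 2 - 4))) + 1 / 2) * R₀ ^ 3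
              + ((10 * ((N₀ : ℝ) ^ 2 / (2 * ((N₀ : ℝ) ^ 2 - 4))) + 1 / 2) / N₀) * (R₀ ^ 2 / q)) / (1 / 2 - R₀)) := by
  have h0 : (3 : ℝ) ≤ N₀ := by exact_mod_cast hN₀
  have h1 : (N₀ : ℝ) ≤ N := by exact_mod_cast hN
  have hN4 : (0 : ℝ) < (N : ℝ) ^ 2 - 4 := by nlinarith
  have hN1 : (0 : ℝ) < (N : ℝ) ^ 2 - 1 := by nlinarith
  have hN4' : (0 : ℝ) < (N₀ : ℝ) ^ 2 - 4 := by nlinarith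
  have hN1' : (0 : ℝ) < (N₀ : ℝ) ^ 2 - 1 := by nlinarith
  have hNpos : (0 : ℝ) < N := by linarith
  have hN₀pos : (0 : ℝ) < N₀ := by linarith
  have hC := casimirFactor_le (N₀ := N₀) (N := N) (by omega) hN
  have hE := levelTwoE_le hN₀ hN
  set C : ℝ := (N : ℝ) ^ 2 / ((N : ℝ) ^ 2 - 1) with hCdef
  set E : ℝ := (N : ℝ) ^ 2 / (2 * ((N : ℝ) ^ 2 - 4)) with hEdef
  set C₀ : ℝ := (N₀ : ℝ) ^ 2 / ((N₀ : ℝ) ^ 2 - 1) with hC₀def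
  set E₀ : ℝ := (N₀ : ℝ) ^ 2 / (2 * ((N₀ : ℝ) ^ 2 - 4)) with hE₀def
  have hC0 : 0 ≤ C := div_nonneg (by positivity) hN1.le
  have hC₀0 : 0 ≤ C₀ := div_nonneg (by positivity) hN1'.le
  have hE0 : 0 ≤ E := by positivity
  have hE₀0 : 0 ≤ E₀ := by positivity
  have hR₀0 : 0 ≤ R₀ := hR0.trans hRR₀
  have hT₀ : 0 < 1 / 2 - R₀ := by linarith
  have hT : 0 < 1 / 2 - R := by linarith
  have hsq : q ≤ Real.sqrt (1 / 2 - R) := by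
    rw [show q = Real.sqrt (q ^ 2) from (Real.sqrt_sq hq.le).symm]
    exact Real.sqrt_le_sqrt (by linarith)
  have p2 : R ^ 2 ≤ R₀ ^ 2 := pow_le_pow_left₀ hR0 hRR₀ 2
  have p3 : R ^ 3 ≤ R₀ ^ 3 := pow_le_pow_left₀ hR0 hRR₀ 3
  have q1 : R / Real.sqrt (1 / 2 - R) ≤ R₀ / q := div_le_div₀ hR₀0 hRR₀ hq hsq
  have q2 : R ^ 2 / Real.sqrt (1 / 2 - R) ≤ R₀ ^ 2 / q := div_le_div₀ (by positivity) p2 hq hsq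
  have d1 : (E + 1 / 4) / N ≤ (E₀ + 1 / 4) / N₀ := div_le_div₀ (by positivity) (by linarith) hN₀pos h1
  have d2 : (10 * E + 1 / 2) / N ≤ (10 * E₀ + 1 / 2) / N₀ := div_le_div₀ (by positivity) (by linarith) hN₀pos h1
  have t1 : E * R ≤ E₀ * R₀ := mul_le_mul hE hRR₀ hR0 hE₀0
  have t2 : 4 * C * (E + 1 / 4) * R ^ 2 ≤ 4 * C₀ * (E₀ + 1 / 4) * R₀ ^ 2 := by
    have a : 4 * C * (E + 1 / 4) ≤ 4 * C₀ * (E₀ + 1 / 4) := by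
      have := mul_le_mul hC (by linarith : E + 1 / 4 ≤ E₀ + 1 / 4) (by positivity) hC₀0
      linarith
    exact mul_le_mul a p2 (by positivity) (by positivity)
  have t3 : 2 * ((E + 1 / 4) / N) * (R / Real.sqrt (1 / 2 - R)) ≤ 2 * ((E₀ + 1 / 4) / N₀) * (R₀ / q) :=
    mul_le_mul (by linarith) q1 (by positivity) (by positivity)
  have n1 : (5 * E + 1 / 4) * R ^ 2 ≤ (5 * E₀ + 1 / 4) * R₀ ^ 2 := mul_le_mul (by linarith) p2 (by positivity) (by positivity)
  have n2 : 2 * C * (10 * E + 1 / 2) * R ^ 3 ≤ 2 * C₀ * (10 * E₀ + 1 / 2) * R₀ ^ 3 := by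
    have a : 2 * C * (10 * E + 1 / 2) ≤ 2 * C₀ * (10 * E₀ + 1 / 2) := by
      have := mul_le_mul hC (by linarith : 10 * E + 1 / 2 ≤ 10 * E₀ + 1 / 2) (by positivity) hC₀0
      linarith
    exact mul_le_mul a p3 (by positivity) (by positivity)
  have n3 : ((10 * E + 1 / 2) / N) * (R ^ 2 / Real.sqrt (1 / 2 - R)) ≤ ((10 * E₀ + 1 / 2) / N₀) * (R₀ ^ 2 / q) :=
    mul_le_mul d2 q2 (by positivity) (by positivity)
  have hnum0 : 0 ≤ (5 * E₀ + 1 / 4) * R₀ ^ 2 + 2 * C₀ * (10 * E₀ + 1 / 2) * R₀ ^ 3 + ((10 * E₀ + 1 / 2) / N₀) * (R₀ ^ 2 / q) := by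
    positivity
  have hfrac : ((5 * E + 1 / 4) * R ^ 2 + 2 * C * (10 * E + 1 / 2) * R ^ 3 + ((10 * E + 1 / 2) / N) * (R ^ 2 / Real.sqrt (1 / 2 - R)))
      / (1 / 2 - R) ≤
      ((5 * E₀ + 1 / 4) * R₀ ^ 2 + 2 * C₀ * (10 * E₀ + 1 / 2) * R₀ ^ 3 + ((10 * E₀ + 1 / 2) / N₀) * (R₀ ^ 2 / q)) / (1 / 2 - R₀) :=
    div_le_div₀ hnum0 (by linarith only [n1, n2, n3]) hT₀ (by linarith only [hRR₀])
  have hbody0 : 0 ≤ 1 + E * R + 4 * C * (E + 1 / 4) * R ^ 2 + 2 * ((E + 1 / 4) / N) * (R / Real.sqrt (1 / 2 - R))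
      + ((5 * E + 1 / 4) * R ^ 2 + 2 * C * (10 * E + 1 / 2) * R ^ 3 + ((10 * E + 1 / 2) / N) * (R ^ 2 / Real.sqrt (1 / 2 - R)))
        / (1 / 2 - R) := by positivity
  exact mul_le_mul hC (by linarith only [t1, t2, t3, hfrac]) hbody0 hC₀0

/-- **`MassGapAt 4 N x` for every `N ≥ 4` at every 't Hooft `|x| ≤ 4 / 125`** (`0.032`), hypothesis-free, by the DS route (star door)
with the level-two one-link modulus. [folklore] -/
theorem massGapAt_SU_levelTwo_four (hN : 4 ≤ N) {x : ℝ} (h : |x| ≤ 4 / 125) : MassGapAt 4 N x := by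
  have hx0 : 0 ≤ |x| := abs_nonneg x
  have hR : |x| * 6 < 1 / 2 := by linarith
  have hN3 : 3 ≤ N := by omega
  have hK := levelTwoK_le (N₀ := 4) (N := N) (by norm_num) hN (R := |x| * 6) (R₀ := 24 / 125) (q := 5549 / 10000)
    (by positivity) (by linarith) (by norm_num) (by norm_num) (by norm_num)
  have hK0 : 0 ≤ (N : ℝ) ^ 2 / ((N : ℝ) ^ 2 - 1) *
        (1 + ((N : ℝ) ^ 2 / (2 * ((N : ℝ) ^ 2 - 4))) * (|x| * 6) + 4 * ((N : ℝ) ^ 2 / ((N : ℝ) ^ 2 - 1)) * (((N : ℝ) ^ 2 / (2 * ((N : ℝ) ^ 2 - 4))) + 1 / 4) * (|x| * 6) ^ 2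
          + 2 * ((((N : ℝ) ^ 2 / (2 * ((N : ℝ) ^ 2 - 4))) + 1 / 4) / N) * ((|x| * 6) / Real.sqrt (1 / 2 - (|x| * 6)))
          + ((5 * ((N : ℝ) ^ 2 / (2 * ((N : ℝ) ^ 2 - 4))) + 1 / 4) * (|x| * 6) ^ 2 + 2 * ((N : ℝ) ^ 2 / ((N : ℝ) ^ 2 - 1)) * (10 * ((N : ℝ) ^ 2 / (2 * ((N : ℝ) ^ 2 - 4))) + 1 / 2) * (|x| * 6) ^ 3
              + ((10 * ((N : ℝ) ^ 2 / (2 * ((N : ℝ) ^ 2 - 4))) + 1 / 2) / N) * ((|x| * 6) ^ 2 / Real.sqrt (1 / 2 - (|x| * 6)))) / (1 / 2 - (|x| * 6))) := by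
    have h10 : (4 : ℝ) ≤ N := by exact_mod_cast hN
    have hN4 : (0 : ℝ) < (N : ℝ) ^ 2 - 4 := by nlinarith
    have hN1 : (0 : ℝ) < (N : ℝ) ^ 2 - 1 := by nlinarith
    have : 0 ≤ (N : ℝ) ^ 2 / ((N : ℝ) ^ 2 - 1) := div_nonneg (by positivity) hN1.le
    have : 0 ≤ (N : ℝ) ^ 2 / (2 * ((N : ℝ) ^ 2 - 4)) := div_nonneg (by positivity) (by positivity)
    have : 0 < 1 / 2 - |x| * 6 := by linarith
    positivity
  refine star_massGapAt_of_oneLinkKRModulus (by omega) hK0 le_rfl (oneLinkKRModulus_levelTwo hN3 hR) ?_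
  have hnum : ((4 : ℝ) ^ 2 / ((4 : ℝ) ^ 2 - 1)) *
        (1 + ((4 : ℝ) ^ 2 / (2 * ((4 : ℝ) ^ 2 - 4))) * (24 / 125) + 4 * ((4 : ℝ) ^ 2 / ((4 : ℝ) ^ 2 - 1)) * (((4 : ℝ) ^ 2 / (2 * ((4 : ℝ) ^ 2 - 4))) + 1 / 4) * (24 / 125) ^ 2
          + 2 * ((((4 : ℝ) ^ 2 / (2 * ((4 : ℝ) ^ 2 - 4))) + 1 / 4) / (4 : ℝ)) * ((24 / 125) / (5549 / 10000))
          + ((5 * ((4 : ℝ) ^ 2 / (2 * ((4 : ℝ) ^ 2 - 4))) + 1 / 4) * (24 / 125) ^ 2 + 2 * ((4 : ℝ) ^ 2 / ((4 : ℝ) ^ 2 - 1)) * (10 * ((4 : ℝ) ^ 2 / (2 * ((4 : ℝ) ^ 2 - 4))) + 1 / 2) * (24 / 125) ^ 3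
              + ((10 * ((4 : ℝ) ^ 2 / (2 * ((4 : ℝ) ^ 2 - 4))) + 1 / 2) / (4 : ℝ)) * ((24 / 125) ^ 2 / (5549 / 10000))) / (1 / 2 - (24 / 125))) * (4 / 125) ≤ 9 / 100 := by
    norm_num
  push_cast at hK
  nlinarith [mul_le_mul hK h (abs_nonneg x) (by norm_num), hK0]

/-- **`ImprovedThreshold 4 N (4 / 125)` for every `N ≥ 4`, hypothesis-free** (`0.032`). [folklore] -/
theorem improvedThreshold_SU_levelTwo_four (hN : 4 ≤ N) : ImprovedThreshold 4 N (4 / 125) :=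
  ⟨by norm_num, fun _ hx => massGapAt_SU_levelTwo_four hN hx.le⟩

/-- **`MassGapAt 4 N x` for every `N ≥ 6` at every 't Hooft `|x| ≤ 69 / 2000`** (`0.0345`), hypothesis-free, by the DS route (star door)
with the level-two one-link modulus. [folklore] -/
theorem massGapAt_SU_levelTwo_six (hN : 6 ≤ N) {x : ℝ} (h : |x| ≤ 69 / 2000) : MassGapAt 4 N x := by
  have hx0 : 0 ≤ |x| := abs_nonneg x
  have hR : |x| * 6 < 1 / 2 := by linarith
  have hN3 : 3 ≤ N := by omega
  have hK := levelTwoK_le (N₀ := 6) (N := N) (by norm_num) hN (R := |x| * 6) (R₀ := 207 / 1000) (q := 1353 / 2500)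
    (by positivity) (by linarith) (by norm_num) (by norm_num) (by norm_num)
  have hK0 : 0 ≤ (N : ℝ) ^ 2 / ((N : ℝ) ^ 2 - 1) *
        (1 + ((N : ℝ) ^ 2 / (2 * ((N : ℝ) ^ 2 - 4))) * (|x| * 6) + 4 * ((N : ℝ) ^ 2 / ((N : ℝ) ^ 2 - 1)) * (((N : ℝ) ^ 2 / (2 * ((N : ℝ) ^ 2 - 4))) + 1 / 4) * (|x| * 6) ^ 2
          + 2 * ((((N : ℝ) ^ 2 / (2 * ((N : ℝ) ^ 2 - 4))) + 1 / 4) / N) * ((|x| * 6) / Real.sqrt (1 / 2 - (|x| * 6)))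
          + ((5 * ((N : ℝ) ^ 2 / (2 * ((N : ℝ) ^ 2 - 4))) + 1 / 4) * (|x| * 6) ^ 2 + 2 * ((N : ℝ) ^ 2 / ((N : ℝ) ^ 2 - 1)) * (10 * ((N : ℝ) ^ 2 / (2 * ((N : ℝ) ^ 2 - 4))) + 1 / 2) * (|x| * 6) ^ 3
              + ((10 * ((N : ℝ) ^ 2 / (2 * ((N : ℝ) ^ 2 - 4))) + 1 / 2) / N) * ((|x| * 6) ^ 2 / Real.sqrt (1 / 2 - (|x| * 6)))) / (1 / 2 - (|x| * 6))) := by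
    have h10 : (6 : ℝ) ≤ N := by exact_mod_cast hN
    have hN4 : (0 : ℝ) < (N : ℝ) ^ 2 - 4 := by nlinarith
    have hN1 : (0 : ℝ) < (N : ℝ) ^ 2 - 1 := by nlinarith
    have : 0 ≤ (N : ℝ) ^ 2 / ((N : ℝ) ^ 2 - 1) := div_nonneg (by positivity) hN1.le
    have : 0 ≤ (N : ℝ) ^ 2 / (2 * ((N : ℝ) ^ 2 - 4)) := div_nonneg (by positivity) (by positivity)
    have : 0 < 1 / 2 - |x| * 6 := by linarith
    positivity
  refine star_massGapAt_of_oneLinkKRModulus (by omega) hK0 le_rfl (oneLinkKRModulus_levelTwo hN3 hR) ?_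
  have hnum : ((6 : ℝ) ^ 2 / ((6 : ℝ) ^ 2 - 1)) *
        (1 + ((6 : ℝ) ^ 2 / (2 * ((6 : ℝ) ^ 2 - 4))) * (207 / 1000) + 4 * ((6 : ℝ) ^ 2 / ((6 : ℝ) ^ 2 - 1)) * (((6 : ℝ) ^ 2 / (2 * ((6 : ℝ) ^ 2 - 4))) + 1 / 4) * (207 / 1000) ^ 2
          + 2 * ((((6 : ℝ) ^ 2 / (2 * ((6 : ℝ) ^ 2 - 4))) + 1 / 4) / (6 : ℝ)) * ((207 / 1000) / (1353 / 2500))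
          + ((5 * ((6 : ℝ) ^ 2 / (2 * ((6 : ℝ) ^ 2 - 4))) + 1 / 4) * (207 / 1000) ^ 2 + 2 * ((6 : ℝ) ^ 2 / ((6 : ℝ) ^ 2 - 1)) * (10 * ((6 : ℝ) ^ 2 / (2 * ((6 : ℝ) ^ 2 - 4))) + 1 / 2) * (207 / 1000) ^ 3
              + ((10 * ((6 : ℝ) ^ 2 / (2 * ((6 : ℝ) ^ 2 - 4))) + 1 / 2) / (6 : ℝ)) * ((207 / 1000) ^ 2 / (1353 / 2500))) / (1 / 2 - (207 / 1000))) * (69 / 2000) ≤ 9 / 100 := by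
    norm_num
  push_cast at hK
  nlinarith [mul_le_mul hK h (abs_nonneg x) (by norm_num), hK0]

/-- **`ImprovedThreshold 4 N (69 / 2000)` for every `N ≥ 6`, hypothesis-free** (`0.0345`). [folklore] -/
theorem improvedThreshold_SU_levelTwo_six (hN : 6 ≤ N) : ImprovedThreshold 4 N (69 / 2000) :=
  ⟨by norm_num, fun _ hx => massGapAt_SU_levelTwo_six hN hx.le⟩

/-- **`MassGapAt 4 N x` for every `N ≥ 10` at every 't Hooft `|x| ≤ 73 / 2000`** (`0.0365`), hypothesis-free, by the DS route (star door)
with the level-two one-link modulus. [folklore] -/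
theorem massGapAt_SU_levelTwo_ten (hN : 10 ≤ N) {x : ℝ} (h : |x| ≤ 73 / 2000) : MassGapAt 4 N x := by
  have hx0 : 0 ≤ |x| := abs_nonneg x
  have hR : |x| * 6 < 1 / 2 := by linarith
  have hN3 : 3 ≤ N := by omega
  have hK := levelTwoK_le (N₀ := 10) (N := N) (by norm_num) hN (R := |x| * 6) (R₀ := 219 / 1000) (q := 53 / 100)
    (by positivity) (by linarith) (by norm_num) (by norm_num) (by norm_num)
  have hK0 : 0 ≤ (N : ℝ) ^ 2 / ((N : ℝ) ^ 2 - 1) *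
        (1 + ((N : ℝ) ^ 2 / (2 * ((N : ℝ) ^ 2 - 4))) * (|x| * 6) + 4 * ((N : ℝ) ^ 2 / ((N : ℝ) ^ 2 - 1)) * (((N : ℝ) ^ 2 / (2 * ((N : ℝ) ^ 2 - 4))) + 1 / 4) * (|x| * 6) ^ 2
          + 2 * ((((N : ℝ) ^ 2 / (2 * ((N : ℝ) ^ 2 - 4))) + 1 / 4) / N) * ((|x| * 6) / Real.sqrt (1 / 2 - (|x| * 6)))
          + ((5 * ((N : ℝ) ^ 2 / (2 * ((N : ℝ) ^ 2 - 4))) + 1 / 4) * (|x| * 6) ^ 2 + 2 * ((N : ℝ) ^ 2 / ((N : ℝ) ^ 2 - 1)) * (10 * ((N : ℝ) ^ 2 / (2 * ((N : ℝ) ^ 2 - 4))) + 1 / 2) * (|x| * 6) ^ 3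
              + ((10 * ((N : ℝ) ^ 2 / (2 * ((N : ℝ) ^ 2 - 4))) + 1 / 2) / N) * ((|x| * 6) ^ 2 / Real.sqrt (1 / 2 - (|x| * 6)))) / (1 / 2 - (|x| * 6))) := by
    have h10 : (10 : ℝ) ≤ N := by exact_mod_cast hN
    have hN4 : (0 : ℝ) < (N : ℝ) ^ 2 - 4 := by nlinarith
    have hN1 : (0 : ℝ) < (N : ℝ) ^ 2 - 1 := by nlinarith
    have : 0 ≤ (N : ℝ) ^ 2 / ((N : ℝ) ^ 2 - 1) := div_nonneg (by positivity) hN1.le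
    have : 0 ≤ (N : ℝ) ^ 2 / (2 * ((N : ℝ) ^ 2 - 4)) := div_nonneg (by positivity) (by positivity)
    have : 0 < 1 / 2 - |x| * 6 := by linarith
    positivity
  refine star_massGapAt_of_oneLinkKRModulus (by omega) hK0 le_rfl (oneLinkKRModulus_levelTwo hN3 hR) ?_
  have hnum : ((10 : ℝ) ^ 2 / ((10 : ℝ) ^ 2 - 1)) *
        (1 + ((10 : ℝ) ^ 2 / (2 * ((10 : ℝ) ^ 2 - 4))) * (219 / 1000) + 4 * ((10 : ℝ) ^ 2 / ((10 : ℝ) ^ 2 - 1)) * (((10 : ℝ) ^ 2 / (2 * ((10 : ℝ) ^ 2 - 4))) + 1 / 4) * (219 / 1000) ^ 2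
          + 2 * ((((10 : ℝ) ^ 2 / (2 * ((10 : ℝ) ^ 2 - 4))) + 1 / 4) / (10 : ℝ)) * ((219 / 1000) / (53 / 100))
          + ((5 * ((10 : ℝ) ^ 2 / (2 * ((10 : ℝ) ^ 2 - 4))) + 1 / 4) * (219 / 1000) ^ 2 + 2 * ((10 : ℝ) ^ 2 / ((10 : ℝ) ^ 2 - 1)) * (10 * ((10 : ℝ) ^ 2 / (2 * ((10 : ℝ) ^ 2 - 4))) + 1 / 2) * (219 / 1000) ^ 3
              + ((10 * ((10 : ℝ) ^ 2 / (2 * ((10 : ℝ) ^ 2 - 4))) + 1 / 2) / (10 : ℝ)) * ((219 / 1000) ^ 2 / (53 / 100))) / (1 / 2 - (219 / 1000))) * (73 / 2000) ≤ 9 / 100 := by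
    norm_num
  push_cast at hK
  nlinarith [mul_le_mul hK h (abs_nonneg x) (by norm_num), hK0]

/-- **`ImprovedThreshold 4 N (73 / 2000)` for every `N ≥ 10`, hypothesis-free** (`0.0365`). [folklore] -/
theorem improvedThreshold_SU_levelTwo_ten (hN : 10 ≤ N) : ImprovedThreshold 4 N (73 / 2000) :=
  ⟨by norm_num, fun _ hx => massGapAt_SU_levelTwo_ten hN hx.le⟩

/-- **`MassGapAt 4 N x` for every `N ≥ 20` at every 't Hooft `|x| ≤ 3 / 80`** (`0.0375`), hypothesis-free, by the DS route (star door)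
with the level-two one-link modulus. [folklore] -/
theorem massGapAt_SU_levelTwo_twenty (hN : 20 ≤ N) {x : ℝ} (h : |x| ≤ 3 / 80) : MassGapAt 4 N x := by
  have hx0 : 0 ≤ |x| := abs_nonneg x
  have hR : |x| * 6 < 1 / 2 := by linarith
  have hN3 : 3 ≤ N := by omega
  have hK := levelTwoK_le (N₀ := 20) (N := N) (by norm_num) hN (R := |x| * 6) (R₀ := 9 / 40) (q := 1311 / 2500)
    (by positivity) (by linarith) (by norm_num) (by norm_num) (by norm_num)
  have hK0 : 0 ≤ (N : ℝ) ^ 2 / ((N : ℝ) ^ 2 - 1) *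
        (1 + ((N : ℝ) ^ 2 / (2 * ((N : ℝ) ^ 2 - 4))) * (|x| * 6) + 4 * ((N : ℝ) ^ 2 / ((N : ℝ) ^ 2 - 1)) * (((N : ℝ) ^ 2 / (2 * ((N : ℝ) ^ 2 - 4))) + 1 / 4) * (|x| * 6) ^ 2
          + 2 * ((((N : ℝ) ^ 2 / (2 * ((N : ℝ) ^ 2 - 4))) + 1 / 4) / N) * ((|x| * 6) / Real.sqrt (1 / 2 - (|x| * 6)))
          + ((5 * ((N : ℝ) ^ 2 / (2 * ((N : ℝ) ^ 2 - 4))) + 1 / 4) * (|x| * 6) ^ 2 + 2 * ((N : ℝ) ^ 2 / ((N : ℝ) ^ 2 - 1)) * (10 * ((N : ℝ) ^ 2 / (2 * ((N : ℝ) ^ 2 - 4))) + 1 / 2) * (|x| * 6) ^ 3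
              + ((10 * ((N : ℝ) ^ 2 / (2 * ((N : ℝ) ^ 2 - 4))) + 1 / 2) / N) * ((|x| * 6) ^ 2 / Real.sqrt (1 / 2 - (|x| * 6)))) / (1 / 2 - (|x| * 6))) := by
    have h10 : (20 : ℝ) ≤ N := by exact_mod_cast hN
    have hN4 : (0 : ℝ) < (N : ℝ) ^ 2 - 4 := by nlinarith
    have hN1 : (0 : ℝ) < (N : ℝ) ^ 2 - 1 := by nlinarith
    have : 0 ≤ (N : ℝ) ^ 2 / ((N : ℝ) ^ 2 - 1) := div_nonneg (by positivity) hN1.le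
    have : 0 ≤ (N : ℝ) ^ 2 / (2 * ((N : ℝ) ^ 2 - 4)) := div_nonneg (by positivity) (by positivity)
    have : 0 < 1 / 2 - |x| * 6 := by linarith
    positivity
  refine star_massGapAt_of_oneLinkKRModulus (by omega) hK0 le_rfl (oneLinkKRModulus_levelTwo hN3 hR) ?_
  have hnum : ((20 : ℝ) ^ 2 / ((20 : ℝ) ^ 2 - 1)) *
        (1 + ((20 : ℝ) ^ 2 / (2 * ((20 : ℝ) ^ 2 - 4))) * (9 / 40) + 4 * ((20 : ℝ) ^ 2 / ((20 : ℝ) ^ 2 - 1)) * (((20 : ℝ) ^ 2 / (2 * ((20 : ℝ) ^ 2 - 4))) + 1 / 4) * (9 / 40) ^ 2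
          + 2 * ((((20 : ℝ) ^ 2 / (2 * ((20 : ℝ) ^ 2 - 4))) + 1 / 4) / (20 : ℝ)) * ((9 / 40) / (1311 / 2500))
          + ((5 * ((20 : ℝ) ^ 2 / (2 * ((20 : ℝ) ^ 2 - 4))) + 1 / 4) * (9 / 40) ^ 2 + 2 * ((20 : ℝ) ^ 2 / ((20 : ℝ) ^ 2 - 1)) * (10 * ((20 : ℝ) ^ 2 / (2 * ((20 : ℝ) ^ 2 - 4))) + 1 / 2) * (9 / 40) ^ 3
              + ((10 * ((20 : ℝ) ^ 2 / (2 * ((20 : ℝ) ^ 2 - 4))) + 1 / 2) / (20 : ℝ)) * ((9 / 40) ^ 2 / (1311 / 2500))) / (1 / 2 - (9 / 40))) * (3 / 80) ≤ 9 / 100 := by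
    norm_num
  push_cast at hK
  nlinarith [mul_le_mul hK h (abs_nonneg x) (by norm_num), hK0]

/-- **`ImprovedThreshold 4 N (3 / 80)` for every `N ≥ 20`, hypothesis-free** (`0.0375`). [folklore] -/
theorem improvedThreshold_SU_levelTwo_twenty (hN : 20 ≤ N) : ImprovedThreshold 4 N (3 / 80) :=
  ⟨by norm_num, fun _ hx => massGapAt_SU_levelTwo_twenty hN hx.le⟩

/-- **`MassGapAt 4 N x` for every `N ≥ 50` at every 't Hooft `|x| ≤ 19 / 500`** (`0.038`), hypothesis-free, by the DS route (star door)
with the level-two one-link modulus. [folklore] -/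
theorem massGapAt_SU_levelTwo_fifty (hN : 50 ≤ N) {x : ℝ} (h : |x| ≤ 19 / 500) : MassGapAt 4 N x := by
  have hx0 : 0 ≤ |x| := abs_nonneg x
  have hR : |x| * 6 < 1 / 2 := by linarith
  have hN3 : 3 ≤ N := by omega
  have hK := levelTwoK_le (N₀ := 50) (N := N) (by norm_num) hN (R := |x| * 6) (R₀ := 57 / 250) (q := 1043 / 2000)
    (by positivity) (by linarith) (by norm_num) (by norm_num) (by norm_num)
  have hK0 : 0 ≤ (N : ℝ) ^ 2 / ((N : ℝ) ^ 2 - 1) *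
        (1 + ((N : ℝ) ^ 2 / (2 * ((N : ℝ) ^ 2 - 4))) * (|x| * 6) + 4 * ((N : ℝ) ^ 2 / ((N : ℝ) ^ 2 - 1)) * (((N : ℝ) ^ 2 / (2 * ((N : ℝ) ^ 2 - 4))) + 1 / 4) * (|x| * 6) ^ 2
          + 2 * ((((N : ℝ) ^ 2 / (2 * ((N : ℝ) ^ 2 - 4))) + 1 / 4) / N) * ((|x| * 6) / Real.sqrt (1 / 2 - (|x| * 6)))
          + ((5 * ((N : ℝ) ^ 2 / (2 * ((N : ℝ) ^ 2 - 4))) + 1 / 4) * (|x| * 6) ^ 2 + 2 * ((N : ℝ) ^ 2 / ((N : ℝ) ^ 2 - 1)) * (10 * ((N : ℝ) ^ 2 / (2 * ((N : ℝ) ^ 2 - 4))) + 1 / 2) * (|x| * 6) ^ 3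
              + ((10 * ((N : ℝ) ^ 2 / (2 * ((N : ℝ) ^ 2 - 4))) + 1 / 2) / N) * ((|x| * 6) ^ 2 / Real.sqrt (1 / 2 - (|x| * 6)))) / (1 / 2 - (|x| * 6))) := by
    have h10 : (50 : ℝ) ≤ N := by exact_mod_cast hN
    have hN4 : (0 : ℝ) < (N : ℝ) ^ 2 - 4 := by nlinarith
    have hN1 : (0 : ℝ) < (N : ℝ) ^ 2 - 1 := by nlinarith
    have : 0 ≤ (N : ℝ) ^ 2 / ((N : ℝ) ^ 2 - 1) := div_nonneg (by positivity) hN1.le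
    have : 0 ≤ (N : ℝ) ^ 2 / (2 * ((N : ℝ) ^ 2 - 4)) := div_nonneg (by positivity) (by positivity)
    have : 0 < 1 / 2 - |x| * 6 := by linarith
    positivity
  refine star_massGapAt_of_oneLinkKRModulus (by omega) hK0 le_rfl (oneLinkKRModulus_levelTwo hN3 hR) ?_
  have hnum : ((50 : ℝ) ^ 2 / ((50 : ℝ) ^ 2 - 1)) *
        (1 + ((50 : ℝ) ^ 2 / (2 * ((50 : ℝ) ^ 2 - 4))) * (57 / 250) + 4 * ((50 : ℝ) ^ 2 / ((50 : ℝ) ^ 2 - 1)) * (((50 : ℝ) ^ 2 / (2 * ((50 : ℝ) ^ 2 - 4))) + 1 / 4) * (57 / 250) ^ 2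
          + 2 * ((((50 : ℝ) ^ 2 / (2 * ((50 : ℝ) ^ 2 - 4))) + 1 / 4) / (50 : ℝ)) * ((57 / 250) / (1043 / 2000))
          + ((5 * ((50 : ℝ) ^ 2 / (2 * ((50 : ℝ) ^ 2 - 4))) + 1 / 4) * (57 / 250) ^ 2 + 2 * ((50 : ℝ) ^ 2 / ((50 : ℝ) ^ 2 - 1)) * (10 * ((50 : ℝ) ^ 2 / (2 * ((50 : ℝ) ^ 2 - 4))) + 1 / 2) * (57 / 250) ^ 3
              + ((10 * ((50 : ℝ) ^ 2 / (2 * ((50 : ℝ) ^ 2 - 4))) + 1 / 2) / (50 : ℝ)) * ((57 / 250) ^ 2 / (1043 / 2000))) / (1 / 2 - (57 / 250))) * (19 / 500) ≤ 9 / 100 := by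
    norm_num
  push_cast at hK
  nlinarith [mul_le_mul hK h (abs_nonneg x) (by norm_num), hK0]

/-- **`ImprovedThreshold 4 N (19 / 500)` for every `N ≥ 50`, hypothesis-free** (`0.038`). [folklore] -/
theorem improvedThreshold_SU_levelTwo_fifty (hN : 50 ≤ N) : ImprovedThreshold 4 N (19 / 500) :=
  ⟨by norm_num, fun _ hx => massGapAt_SU_levelTwo_fifty hN hx.le⟩

/-- The numbers: `1/32 < 4/125 < 69/2000 < 73/2000 < 3/80 < 19/500` and the refined rows they supersede
(`33/1000 < 69/2000`, `17/500 < 73/2000`, `7/200 < 3/80`, `9/250 < 19/500`). [folklore] -/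
theorem threshold_numbers_levelTwo :
    (1 : ℝ) / 32 < 4 / 125 ∧ (4 : ℝ) / 125 < 69 / 2000 ∧ (69 : ℝ) / 2000 < 73 / 2000 ∧ (73 : ℝ) / 2000 < 3 / 80 ∧
      (3 : ℝ) / 80 < 19 / 500 ∧ (33 : ℝ) / 1000 < 69 / 2000 ∧ (17 : ℝ) / 500 < 73 / 2000 ∧ (7 : ℝ) / 200 < 3 / 80 ∧
      (9 : ℝ) / 250 < 19 / 500 := by
  norm_num

end LevelTwoRows

end Summit.Ventures.YMGap.OneLinkEigen
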